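import Literature.NumberTheory.EllipticCurves.KubertTate289CubicLocalOdd
import HarnessLib

/-!
# `E_{28/9}` over its cubic `2`-division field: the support of `(B')`

Topic `NumberTheory/EllipticCurves`. For the `2`-isogeny descent of `X = E_{A,B} ≅ E_K` over `K = ℚ(γ)`
(`γ³ - γ² + 27γ + 36 = 0`; `KubertTate289CubicModel`, `KubertTate289CubicLocalOdd`) the `φ`-Selmer group lives in
`K(S, 2)` with `S` the set of finite places dividing `b' = B' = A² - 4B = -463078 + 158036γ - 88849δ`
(Silverman *AEC* X.4.9; tree `TwoIsogenySelmerGroupShaNF.mk_mem_selmerGroup_of_twoIsogenyTorsorHom_mem_sha'`). Here: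

* `support_Bp` — **`supp (B') ⊆ {𝔭₂, 𝔭₃c, 𝔮₇, 𝔮₂₀₆₉}`**: a finite place containing `B'` is `𝔭₂ = (2, γ)`,
  `𝔭₃c = (3, δ - 2)`, `𝔮₇ = (7, γ - 6)` or `𝔮₂₀₆₉ = (2069, γ - 1583)` (numerically `(B') = 𝔭₂¹⁸𝔭₃c¹⁰𝔮₇⁵𝔮₂₀₆₉`):
  `|N(B')| = 2¹⁸3¹⁰7⁵·2069 ∈ v` forces `v ∣ 2, 3, 7, 2069`; the tree's Dedekind–Kummer enumeration of the primes above
  these (`CubicField14483Primes*`) and the residues `φ(B') ≠ 0` exclude `𝔭₃a, 𝔭₃b, 𝔭₇, 𝔭₂₀₆₉`, and `𝔮₂` is excluded by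
  `B' ∈ 𝔭₂¹⁸` with `2²⁰ ∤ N(B')`.

Theorems only; no named facts.

## References
* [SilvermanAEC2009] J. H. Silverman, *The Arithmetic of Elliptic Curves*, 2nd ed. (2009), Prop. X.4.9, Cor. X.4.4.
* [Marcus2018] D. A. Marcus, *Number Fields*, 2nd ed. (2018), Ch. 3 Thm. 22, 27.
-/

noncomputable section

namespace Literature.NumberTheory.EllipticCurves

namespace KubertTate289Cubic

open scoped _root_.Classical _root_.NumberField
open _root_.Polynomial _root_.Module _root_.NumberField _root_.Ideal _root_.IsDedekindDomain
open _root_.WeierstrassCurve _root_.WeierstrassCurve.Affine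
open _root_.Literature.NumberTheory.NumberFields _root_.Literature.NumberTheory.NumberFields.MonicCubic
open _root_.Literature.NumberTheory.NumberFields.CubicField14483

variable {K : Type*} [Field K] [NumberField K] {γ : K}

/-- **`supp (B') ⊆ {𝔭₂, 𝔭₃c, 𝔮₇, 𝔮₂₀₆₉}`**: a finite place containing `B' = -463078 + 158036γ - 88849δ` is one of
`𝔭₂ = ker ψ₁`, `𝔭₃c = ker φ₃` (`δ ↦ 2`), `𝔮₇ = ker φ₇` (`γ ↦ 6`), `𝔮₂₀₆₉ = ker φ₂₀₆₉` (`γ ↦ 1583`) (`N(B') =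
-2¹⁸3¹⁰7⁵·2069` lies in `v`, so `v ∣ 2, 3, 7` or `2069`; the other primes above these are excluded by `φ(B') ≠ 0`, and
`𝔮₂` by `B' ∈ 𝔭₂¹⁸`, `2²⁰ ∤ N(B')`). [cite: Marcus2018, Ch. 3, Thm. 22] -/
theorem support_Bp (hγ : γ ^ 3 - γ ^ 2 + 27 * γ + 36 = 0) (h3 : finrank ℚ K = 3)
    (ψ₁ : 𝓞 K →+* ZMod 2) (φ₃ : 𝓞 K →+* ZMod 3) (hφ₃ : φ₃ (thetaInt (delta_root hγ)) = 2)
    (φ₇ : 𝓞 K →+* ZMod 7) (hφ₇ : φ₇ (thetaInt (aeval_eq hγ)) = 6)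
    (φ₂₀₆₉ : 𝓞 K →+* ZMod 2069) (hφ₂₀₆₉ : φ₂₀₆₉ (thetaInt (aeval_eq hγ)) = 1583)
    (v : HeightOneSpectrum (𝓞 K))
    (hv : ((-463078 : ℤ) : 𝓞 K) + (158036 : ℤ) * thetaInt (aeval_eq hγ) + (-88849 : ℤ) * thetaInt (delta_root hγ) ∈
      v.asIdeal) :
    v.asIdeal = RingHom.ker ψ₁ ∨ v.asIdeal = RingHom.ker φ₃ ∨ v.asIdeal = RingHom.ker φ₇ ∨
      v.asIdeal = RingHom.ker φ₂₀₆₉ := by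
  -- finite facts
  have r7 : ((1 : ℤ) : ZMod 7) ^ 3 + ((-1 : ℤ) : ZMod 7) * ((1 : ℤ) : ZMod 7) ^ 2 + ((27 : ℤ) : ZMod 7) * (1 : ℤ) +
      ((36 : ℤ) : ZMod 7) = 0 := by decide
  have r2069 : ((1278 : ℤ) : ZMod 2069) ^ 3 + ((-1 : ℤ) : ZMod 2069) * ((1278 : ℤ) : ZMod 2069) ^ 2 +
      ((27 : ℤ) : ZMod 2069) * (1278 : ℤ) + ((36 : ℤ) : ZMod 2069) = 0 := by decide
  have eB3a : ((-463078 : ℤ) : ZMod 3) + ((158036 : ℤ) : ZMod 3) * (1 - (0 : ℤ) ^ 2) + ((-88849 : ℤ) : ZMod 3) * (0 : ℤ)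
      ≠ 0 := by decide
  have eB3b : ((-463078 : ℤ) : ZMod 3) + ((158036 : ℤ) : ZMod 3) * (1 - (1 : ℤ) ^ 2) + ((-88849 : ℤ) : ZMod 3) * (1 : ℤ)
      ≠ 0 := by decide
  have e7δ : (5 : ZMod 7) * (((1 : ℤ) : ZMod 7) ^ 2 - (1 : ℤ) + 18) = 6 := by decide
  have eB7 : ((-463078 : ℤ) : ZMod 7) + ((158036 : ℤ) : ZMod 7) * (1 : ℤ) + ((-88849 : ℤ) : ZMod 7) * 6 ≠ 0 := by decide
  have e2069δ : (690 : ZMod 2069) * (((1278 : ℤ) : ZMod 2069) ^ 2 - (1278 : ℤ) + 18) = 1930 := by decide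
  have eB2069 : ((-463078 : ℤ) : ZMod 2069) + ((158036 : ℤ) : ZMod 2069) * (1278 : ℤ) +
      ((-88849 : ℤ) : ZMod 2069) * 1930 ≠ 0 := by decide
  have r18 : ((73668 : ℤ) : ZMod (2 ^ 18)) ^ 3 + ((-1 : ℤ) : ZMod (2 ^ 18)) * ((73668 : ℤ) : ZMod (2 ^ 18)) ^ 2 +
      ((27 : ℤ) : ZMod (2 ^ 18)) * (73668 : ℤ) + ((36 : ℤ) : ZMod (2 ^ 18)) = 0 := by decide
  have hs18 : ((3 : ℕ) : ZMod (2 ^ 18)) * 174763 = 1 := by decide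
  have hs18' : (174763 : ZMod (2 ^ 18)) * 3 = 1 := by decide
  have hd18 : (174763 : ZMod (2 ^ 18)) * (((73668 : ℤ) : ZMod (2 ^ 18)) ^ 2 - ((73668 : ℤ) : ZMod (2 ^ 18)) + 18) =
      173258 := by decide
  have eB18 : ((-463078 : ℤ) : ZMod (2 ^ 18)) + ((158036 : ℤ) : ZMod (2 ^ 18)) * (73668 : ℤ) +
      ((-88849 : ℤ) : ZMod (2 ^ 18)) * 173258 = 0 := by decide
  have hcast : ZMod.castHom (dvd_pow_self 2 (by omega : (18 : ℕ) ≠ 0)) (ZMod 2) ((73668 : ℤ) : ZMod (2 ^ 18)) = 0 := by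
    rw [map_intCast]; decide
  have hnotdvd : ¬ (2 ^ 2 * 2 ^ 18 ∣ (538273698930229248 : ℕ)) := by decide
  haveI : Fact (Nat.Prime 7) := ⟨by norm_num⟩
  haveI : Fact (Nat.Prime 2069) := ⟨by norm_num⟩
  set Bp : 𝓞 K := ((-463078 : ℤ) : 𝓞 K) + (158036 : ℤ) * thetaInt (aeval_eq hγ) +
    (-88849 : ℤ) * thetaInt (delta_root hγ) with hBp
  -- `|N(B')| ∈ v`, so `2, 3, 7` or `2069 ∈ v`
  have hNabs : (Algebra.norm ℤ Bp).natAbs = 538273698930229248 := by rw [hBp, norm_lin3 hγ h3]; norm_num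
  have hNmem : ((538273698930229248 : ℕ) : 𝓞 K) ∈ v.asIdeal := by
    have h := Ideal.absNorm_mem (Ideal.span {Bp})
    rw [Ideal.absNorm_span_singleton, hNabs] at h
    exact (Ideal.span_singleton_le_iff_mem _).mpr hv h
  have hfac : ((538273698930229248 : ℕ) : 𝓞 K) = (2 : 𝓞 K) ^ 18 * (3 : 𝓞 K) ^ 10 * (7 : 𝓞 K) ^ 5 * 2069 := by
    norm_num
  rw [hfac] at hNmem
  have hprime := v.isPrime
  have hcases : (2 : 𝓞 K) ∈ v.asIdeal ∨ (3 : 𝓞 K) ∈ v.asIdeal ∨ (7 : 𝓞 K) ∈ v.asIdeal ∨ (2069 : 𝓞 K) ∈ v.asIdeal := by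
    rcases hprime.mem_or_mem hNmem with h | h
    · rcases hprime.mem_or_mem h with h | h
      · rcases hprime.mem_or_mem h with h | h
        · exact Or.inl (hprime.mem_of_pow_mem 18 h)
        · exact Or.inr (Or.inl (hprime.mem_of_pow_mem 10 h))
      · exact Or.inr (Or.inr (Or.inl (hprime.mem_of_pow_mem 5 h)))
    · exact Or.inr (Or.inr (Or.inr h))
  haveI := hprime
  rcases hcases with h2 | h3' | h7 | h2069
  · -- above `2`: `𝔭₂ = ker ψ₁`, or `𝔮₂`, which is excluded
    have hP := mem_primesOver_of_natCast_mem (K := K) (p := 2) (by exact_mod_cast h2)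
    rcases eq_span_of_mem_primesOver_two hγ h3 hP with h | h
    · left
      rw [h, ker_residueHom_eq_span irreducible_polyQ (aeval_eq hγ) (not_dvd_exponent hγ h3 Nat.prime_two (by norm_num))
        ψ₁ (r := 0) (by rw [psi_two_gamma hγ ψ₁]; simp)]
    · exfalso
      -- `B' ∈ 𝔭₂ ^ 18`
      obtain ⟨ψ, hψγ, hψδ3⟩ := exists_residueHom_two_pow hγ h3 18 73668 r18 174763 hs18
      have hψδ : ψ (thetaInt (delta_root hγ)) = 173258 := by
        have hh := congrArg (fun t => (174763 : ZMod (2 ^ 18)) * t) hψδ3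
        rw [← mul_assoc, hs18', one_mul, hd18] at hh
        exact hh
      have hker := ker_eq_pow_p2 hγ h3 (k := 18) (by norm_num) ψ (by rw [hψγ]; exact hcast) ψ₁ (psi_two_gamma hγ ψ₁)
      have hB18 : Bp ∈ RingHom.ker ψ₁ ^ 18 := by
        rw [← hker, RingHom.mem_ker, hBp]
        simp only [map_add, map_mul, map_intCast, hψγ, hψδ]
        exact eB18
      -- `𝔮₂ ⊓ 𝔭₂¹⁸ = 𝔮₂ 𝔭₂¹⁸` has norm `2²⁰ ∤ N(B')`
      obtain ⟨hQ, hNQ⟩ := q2_mem_primesOver hγ h3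
      have hQne : v.asIdeal ≠ RingHom.ker ψ₁ := by
        intro hh
        have := congrArg Ideal.absNorm hh
        rw [h, hNQ, absNorm_ker_zmod] at this
        norm_num at this
      have hQmax : v.asIdeal.IsMaximal := v.isPrime.isMaximal v.ne_bot
      have hcop : IsCoprime (v.asIdeal ^ 1) (RingHom.ker ψ₁ ^ 18) :=
        isCoprime_pow_of_isMaximal_ne hQmax (ker_zmod_isMaximal ψ₁) hQne 1 18
      rw [pow_one] at hcop
      have hle : Ideal.span {Bp} ≤ v.asIdeal * RingHom.ker ψ₁ ^ 18 := by
        rw [Ideal.mul_eq_inf_of_isCoprime hcop]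
        exact le_inf ((Ideal.span_singleton_le_iff_mem _).mpr hv) ((Ideal.span_singleton_le_iff_mem _).mpr hB18)
      have hdvd := Ideal.absNorm_dvd_absNorm_of_le hle
      rw [map_mul, map_pow, h, hNQ, absNorm_ker_zmod, Ideal.absNorm_span_singleton, hNabs] at hdvd
      exact hnotdvd hdvd
  · -- above `3`: `𝔭₃a, 𝔭₃b` excluded by `φ(B') ≠ 0`
    have hP := mem_primesOver_of_natCast_mem (K := K) (p := 3) (by exact_mod_cast h3')
    obtain ⟨ψ₀, hψ₀δ, hψ₀γ⟩ := exists_residueHom_three hγ h3 0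
    obtain ⟨ψ₁', hψ₁δ, hψ₁γ⟩ := exists_residueHom_three hγ h3 1
    obtain ⟨-, hP'⟩ := eq_ker_of_mem_primesOver_three hγ h3 ψ₀ ψ₁' φ₃ hψ₀δ hψ₁δ (by rw [hφ₃]; simp) hP
    rcases hP' with h | h | h
    · exfalso; apply eB3a
      have hm : Bp ∈ RingHom.ker ψ₀ := h ▸ hv
      rw [RingHom.mem_ker, hBp] at hm
      simpa only [map_add, map_mul, map_intCast, hψ₀γ, hψ₀δ] using hm
    · exfalso; apply eB3b
      have hm : Bp ∈ RingHom.ker ψ₁' := h ▸ hv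
      rw [RingHom.mem_ker, hBp] at hm
      simpa only [map_add, map_mul, map_intCast, hψ₁γ, hψ₁δ] using hm
    · exact Or.inr (Or.inl h)
  · -- above `7`: `𝔭₇ = (7, γ - 1)` excluded
    have hP := mem_primesOver_of_natCast_mem (K := K) (p := 7) (by exact_mod_cast h7)
    obtain ⟨ψ₇, hψ₇γ, hψ₇δ3⟩ := exists_residueHom_gamma hγ h3 (p := 7) (by norm_num) 1 r7
    have hψ₇δ : ψ₇ (thetaInt (delta_root hγ)) = 6 := by
      rw [residueHom_seven_delta hγ ψ₇ _ hψ₇γ]; exact e7δ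
    obtain ⟨-, hP'⟩ := eq_ker_of_mem_primesOver_seven hγ h3 ψ₇ φ₇ hψ₇γ (by rw [hφ₇]; simp) hP
    rcases hP' with h | h
    · exfalso; apply eB7
      have hm : Bp ∈ RingHom.ker ψ₇ := h ▸ hv
      rw [RingHom.mem_ker, hBp] at hm
      simpa only [map_add, map_mul, map_intCast, hψ₇γ, hψ₇δ] using hm
    · exact Or.inr (Or.inr (Or.inl h))
  · -- above `2069`: `𝔭₂₀₆₉ = (2069, γ - 1278)` excluded
    have hP := mem_primesOver_of_natCast_mem (K := K) (p := 2069) (by exact_mod_cast h2069)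
    obtain ⟨ψ', hψ'γ, -⟩ := exists_residueHom_gamma hγ h3 (p := 2069) (by norm_num) 1278 r2069
    have hψ'δ : ψ' (thetaInt (delta_root hγ)) = 1930 := by
      rw [residueHom_2069_delta hγ ψ' _ hψ'γ]; exact e2069δ
    obtain ⟨-, hP'⟩ := eq_ker_of_mem_primesOver_2069 hγ h3 ψ' φ₂₀₆₉ hψ'γ (by rw [hφ₂₀₆₉]; simp) hP
    rcases hP' with h | h
    · exfalso; apply eB2069
      have hm : Bp ∈ RingHom.ker ψ' := h ▸ hv
      rw [RingHom.mem_ker, hBp] at hm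
      simpa only [map_add, map_mul, map_intCast, hψ'γ, hψ'δ] using hm
    · exact Or.inr (Or.inr (Or.inr h))

end KubertTate289Cubic

end Literature.NumberTheory.EllipticCurves

end
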